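import Summits.QuantumFields.YangMills.Theorems.BalabanUVNodesN19DeviationFlagCanonical
import Summits.QuantumFields.YangMills.Theorems.BalabanUVNodesSpineReadingOfRecord13CoPHK

/-!
# BalabanUVNodes ∕ node N19 (NE7) — THE TAIL LETTER AT A KEY READING: at dag-n20-d's `crOfRecord₁₃KAt K₀ kr bd 0` (any dial `kr`, zero shell split) the N20 ∧ N19′ face BODIES of
# K3⁸ stub 2 (a) FORCE, for ANY bad-key reading `bd`, the two-run TAIL letter at the coarse carriers (one centre per step; the classes whose coarse weights' log-ratio violates
# `e^{c_K ∓ F.side⁴·δ_K}` at some admissible source carry relative weight `≤ W_K` in both runs, `W`, `δ` summable), and (b) FOLLOW from that letter for a `bd` that READS the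
# violators — so «∃ bad-key reading, N20 ∧ N19′ at the key reading» IS the tail letter

Cell `pub-ymgap` (HUMAN RULING D-0062 Track A ∕ D-0149 width seats), WIDTH SEAT `pub-ymgap-dag-n19-w1` (node n19 = NE7, seat 1 of 3), generation g5, CLAIM-7 ∕ INTENT-7.  Route
`Summits/QuantumFields/YangMills/Theses/BalabanUVNodes.lean`, key item K3⁸ `SpineGivenEndpointR13SepCoPHV` (stmt-QuantumFields-27366, KEY MAP v2; stub 2 `stub_expansion13HV`:
`∃ jc sh cr, PinnedAtLive jc sh cr ∧ KeyedRelWeight cr ∧ KeyedShellWeight cr ∧ KeyedExtractionV cr ∧ KeyedCoreEdgeHolderD4V β cr …`); filed `--kind proof --supports … --as helper`.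
COUNT-NEUTRAL.  THEOREMS ONLY (0 `def`, 0 `sorry`).  ADDITIVE — imports this seat's g5 `…Theorems.BalabanUVNodesN19DeviationFlagCanonical` (FILE 6: `exists_sourceIndepBad_hybridNE7_iff`;
through it p623522 and the tree's `Core ∕ HybridNE7 ∕ hybridNE7_noShell ∕ shellWeightBound_zero ∕ RelWeightBound`) and dag-n20-d's `…Theorems.BalabanUVNodesSpineReadingOfRecord13CoPHK`
(p608328: `crOfRecord₁₃KAt`, `classSetK₁₃ ∕ weightAK₁₃ ∕ weightBK₁₃ ∕ badClassK₁₃`, `mem_badClassK₁₃_iff`, `badClassK₁₃_subset`, `weightAK₁₃_nonneg ∕ weightBK₁₃_nonneg`,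
`relWeightBound_crOfRecord₁₃KAt`, `core_crOfRecord₁₃KAt`) ONLY; modifies nothing.

WHY.  FILE 6 proved, in the abstract shapes, that at fixed shells ∕ weights ∕ radius the bad class is canonical and the N19′ ∧ N20 pair is ONE two-run tail letter.  The plan's
texts live at dag-n20-d's reading object, whose bad class is `badClassK₁₃ kr bd` for a source-independent bad-key READING `bd` and whose `W`, `δ` are the reading's CANONICAL ones
(`wInf`, `deltaCan`).  THIS FILE transports the equivalence there, in both directions, so that «for SOME bad-key reading the N20 ∧ N19′ face bodies hold at `crOfRecord₁₃KAt K₀ kr bd 0`»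
can be read as exactly one letter about the two runs' coarse class weights.
* §1 [bookkeeping] ★★★ `tailLetter_of_faces_crOfRecord₁₃KAt` — NECESSITY for ANY `bd`: `RelWeightBound cr… cr.W ∧ Core cr… cr.δ ∧ Summable cr.δ` at `cr := crOfRecord₁₃KAt K₀ kr bd 0`
  (+ non-negative fine weights) ⇒ `∃ W δ` (`0 ≤ W < 1`, `Σ W < ∞`, `Σ δ < ∞`) and per step ONE centre `c_K` with: the coarse classes whose log-ratio violates `e^{c_K ∓ F.side⁴·δ_K}` at
  SOME `|t| ≤ 1` carry, at EVERY `|t'| ≤ 1`, `weightAK₁₃`-mass `≤ W_K·Σ weightAK₁₃` and `weightBK₁₃`-mass `≤ W_K·Σ weightBK₁₃` (FILE 6 §4 BY NAME; the record's coarse bad class is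
  source-independent by construction, `badClassK₁₃ … K t = badClassK₁₃ … K 0` definitionally).
* §2 [bookkeeping] ★★★ `faces_crOfRecord₁₃KAt_zeroShell_of_tailLetter` — SUFFICIENCY: centres `c`, summable `δ`, weights `0 ≤ W < 1` summable, a `bd` that READS the violators at the
  tuple (`bd K u ↔ ∃ |t| ≤ 1, violation`), the tail letter stated on `badClassK₁₃ kr bd`, non-negative fine run-A weights ⇒ the two face bodies at the reading with their CANONICAL
  `W`, `δ` (dag-n20-d's transfer lemmas BY NAME).
* §3∕§4 (v1.1, append-only) [bookkeeping] ★★★ `tailLetter_of_faces_crOfRecord₁₃KAt_pinnedShell` · ★★★ `faces_crOfRecord₁₃KAt_pinnedShell_of_tailLetter` — the same two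
  directions at a PINNED, possibly non-zero, shell split `sh` (`crOfRecord₁₃KAt K₀ kr bd sh`): the faces now include N21's `ShellWeightBound cr… cr.Wsh` and `cr.W + cr.Wsh < 1`, the
  letter is stated for the SHELL-SUBTRACTED coarse weights `weightAK₁₃ − sh.1`, `weightBK₁₃ − sh.2`, and sufficiency consumes a shell witness `ShellWeightBound … sh.1 sh.2 Wsh` with
  `W + Wsh < 1` (dag-n20-d's `shellWeightBound_crOfRecord₁₃KAt` ∕ `lt_one_crOfRecord₁₃KAt` BY NAME in addition).
* v1.2 (append-only) [bookkeeping] ★★★ `exists_badKeyReading_faces_crOfRecord₁₃KAt_zeroShell_iff` — the EXISTENCE form at the record object: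
  (`∃ bd : BadKeyReading₁₃ N K₀`, the N20 ∧ N19′ face bodies at `crOfRecord₁₃KAt K₀ kr bd 0`) ↔ (`∃ W δ c`, the tail letter) — ⇐ at the violator reading written as a term.
READINGS (located; nothing proposed).  (i) For the plan's window-key text: with `sh` pinned to zero, «∃ bd, KeyedRelWeight ∧ KeyedCoreEdgeHolder at `crOfRecord₁₃KAt K₀ kr bd 0`»
≡ «∃ c W δ: the tail letter at the `kr`-coarse carriers» — the bad-key reading carries no information beyond the letter; typed readings (persistence ∕ size ∕ count ∕ bill
threshold) are prices (p623522 ∕ p626380 ∕ p627750), lossless iff they contain the violators (FILE 6 §3).  (ii) With a NON-zero pinned shell split the same holds for the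
shell-subtracted coarse weights — v1.1 §3∕§4 carry out that transport for ANY pinned `sh`.  (iii) Nothing here is Bałaban's;
whether the letter holds for the d = 4 densities at any window dial is unprinted and unproved.

HONEST FRAMING.  By-name bookkeeping over dag-n20-d's reading objects and this seat's g5 calculus; nothing of Bałaban's is asserted or instantiated; no estimate of the programme is
proved.  NE7 ∕ NE7b NOT PRINTED as two-run statements for d = 4 ∕ NOT proved; N19 ∕ N20 NOT discharged; K3⁸ OPEN, not claimed, «v6» untouched; counts UNMOVED (typed 28∕28 ·
discharged 5∕27, A 5∕28).  Everything below is PROVED (0 `sorry`, 0 named facts, standard axioms); no decl carries a cite tag.  One finite four-torus programme at fixed ε — NOT ℝ⁴,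
NOT infinite volume, NOT OS, NOT a mass gap, NOT the Clay problem (R4 closes the conditional finite-𝕋⁴ rung `BalabanLadder.UV` only).
-/

noncomputable section

open Finset
open scoped BigOperators

namespace Summit.QuantumFields.YangMills.BalabanUVNodes.N19TailLetterAtKeyReading

open Summit.QuantumFields.BalabanUV.T4Continuum.Spine.NE7 (Core)
open Literature.MathematicalPhysics.QuantumFieldTheory.Balaban1983to89
open Literature.MathematicalPhysics.QuantumFieldTheory.Balaban1983to89.T4Continuum
open Literature.MathematicalPhysics.QuantumFieldTheory.Balaban1983to89.Node00
open T4WeightBudget (RelWeightBound)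
open T4MatchingAssembly (HybridNE7 hybridNE7_noShell)
open YMDAG.UVSplit
open Summit.QuantumFields.YangMills.BalabanUVNodes.N19DeviationFlagCanonical (exists_sourceIndepBad_hybridNE7_iff)

variable {F : T4Family} {N : ℕ} [NeZero N] (K₀ : ℕ) (kr : KeyReading₁₃ N K₀) (bd : BadKeyReading₁₃ N K₀) (θ : Stage13HParams F N) (hP : θ.Provisos₁₃CoPH F N)
  (g₀ : ℕ → ℝ) (os : List (ULoop F))

/-! ## §1 NECESSITY: the faces at `crOfRecord₁₃KAt K₀ kr bd 0` for ANY bad-key reading force the two-run TAIL letter at the coarse carriers [bookkeeping] -/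

open Classical in
/-- **★★★ THE FACES FORCE THE TAIL LETTER** [bookkeeping].  For ANY dial `kr` and ANY bad-key reading `bd`: if the reading `cr := crOfRecord₁₃KAt K₀ kr bd 0` (zero shell split)
carries N20's face `RelWeightBound cr… cr.W` and N19′'s `Core cr… cr.δ ∧ Summable cr.δ` (the two face BODIES of stub 2 at `cr`), and the fine class weights of record are non-negative,
then there are weights `W_K ∈ [0,1)` summable, a summable radius `δ` and per step ONE centre `c_K` such that the coarse classes whose two-run log-ratio VIOLATES
`e^{c_K ∓ F.side⁴·δ_K}` at SOME admissible source carry, at EVERY admissible source, relative weight `≤ W_K` in both runs (g5 FILE 6 `exists_sourceIndepBad_hybridNE7_iff` BY NAME —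
the record's coarse bad class is source-independent by construction). -/
theorem tailLetter_of_faces_crOfRecord₁₃KAt
    (hA0 : ∀ (K : ℕ) (t : ℝ), |t| ≤ 1 → ∀ x ∈ classSet₁₃ θ K₀ g₀ K, 0 ≤ weightA₁₃ θ hP K₀ g₀ os K t x)
    (hB0 : ∀ (K : ℕ) (t : ℝ), |t| ≤ 1 → ∀ x ∈ classSet₁₃ θ K₀ g₀ K, 0 ≤ weightB₁₃ θ hP K₀ g₀ os K t x)
    (hfaces : let cr := crOfRecord₁₃KAt K₀ kr bd (fun _ _ _ _ _ => (fun _ _ _ => 0, fun _ _ _ => 0)) F θ hP g₀ os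
      RelWeightBound cr.l₀ cr.T cr.A cr.B cr.Bad cr.W ∧
        (letI := cr.dec
         Core cr.l₀ cr.vol cr.T cr.Bad (fun K t τ => cr.A K t τ - cr.shA K t τ) (fun K t τ => cr.B K t τ - cr.shB K t τ) cr.δ) ∧ Summable cr.δ) :
    ∃ W δ : ℕ → ℝ, (∀ K, 0 ≤ W K) ∧ (∀ K, W K < 1) ∧ Summable W ∧ Summable δ ∧
      ∀ K : ℕ, ∃ c : ℝ, ∀ t' : ℝ, |t'| ≤ 1 →
        letI : DecidableEq (Σ K, SiteSeqKey F (K₀ + K)) := Classical.decEq _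
        (∑ u ∈ (classSetK₁₃ θ K₀ g₀ (kr F θ hP g₀ os) K).filter (fun u => ∃ t : ℝ, |t| ≤ 1 ∧
            ¬ (Real.exp (c - ((F.side : ℝ) ^ 4) * δ K) * weightAK₁₃ θ hP K₀ g₀ os (kr F θ hP g₀ os) K t u ≤ weightBK₁₃ θ hP K₀ g₀ os (kr F θ hP g₀ os) K t u ∧
              weightBK₁₃ θ hP K₀ g₀ os (kr F θ hP g₀ os) K t u ≤ Real.exp (c + ((F.side : ℝ) ^ 4) * δ K) * weightAK₁₃ θ hP K₀ g₀ os (kr F θ hP g₀ os) K t u)),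
            weightAK₁₃ θ hP K₀ g₀ os (kr F θ hP g₀ os) K t' u ≤ W K * ∑ u ∈ classSetK₁₃ θ K₀ g₀ (kr F θ hP g₀ os) K, weightAK₁₃ θ hP K₀ g₀ os (kr F θ hP g₀ os) K t' u) ∧
        (∑ u ∈ (classSetK₁₃ θ K₀ g₀ (kr F θ hP g₀ os) K).filter (fun u => ∃ t : ℝ, |t| ≤ 1 ∧
            ¬ (Real.exp (c - ((F.side : ℝ) ^ 4) * δ K) * weightAK₁₃ θ hP K₀ g₀ os (kr F θ hP g₀ os) K t u ≤ weightBK₁₃ θ hP K₀ g₀ os (kr F θ hP g₀ os) K t u ∧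
              weightBK₁₃ θ hP K₀ g₀ os (kr F θ hP g₀ os) K t u ≤ Real.exp (c + ((F.side : ℝ) ^ 4) * δ K) * weightAK₁₃ θ hP K₀ g₀ os (kr F θ hP g₀ os) K t u)),
            weightBK₁₃ θ hP K₀ g₀ os (kr F θ hP g₀ os) K t' u ≤ W K * ∑ u ∈ classSetK₁₃ θ K₀ g₀ (kr F θ hP g₀ os) K, weightBK₁₃ θ hP K₀ g₀ os (kr F θ hP g₀ os) K t' u) := by
  letI iS : DecidableEq (Σ K, SiteSeqKey F (K₀ + K)) := Classical.decEq _
  obtain ⟨hW, hcore, hδ⟩ := hfaces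
  have hAK0 : ∀ (K : ℕ) (t : ℝ), |t| ≤ 1 → ∀ u ∈ classSetK₁₃ θ K₀ g₀ (kr F θ hP g₀ os) K, 0 ≤ weightAK₁₃ θ hP K₀ g₀ os (kr F θ hP g₀ os) K t u :=
    fun K t ht u _ => weightAK₁₃_nonneg θ hP K₀ g₀ os (kr F θ hP g₀ os) (hA0 K t ht) u
  have hBK0 : ∀ (K : ℕ) (t : ℝ), |t| ≤ 1 → ∀ u ∈ classSetK₁₃ θ K₀ g₀ (kr F θ hP g₀ os) K, 0 ≤ weightBK₁₃ θ hP K₀ g₀ os (kr F θ hP g₀ os) K t u :=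
    fun K t ht u _ => weightBK₁₃_nonneg θ hP K₀ g₀ os (kr F θ hP g₀ os) (hB0 K t ht) u
  -- the two faces assemble the zero-shell binder list at the coarse carriers, with the record's (source-independent) coarse bad class
  have hH : HybridNE7 1 ((F.side : ℝ) ^ 4) (classSetK₁₃ θ K₀ g₀ (kr F θ hP g₀ os)) (weightAK₁₃ θ hP K₀ g₀ os (kr F θ hP g₀ os)) (weightBK₁₃ θ hP K₀ g₀ os (kr F θ hP g₀ os))
      (fun K _ => badClassK₁₃ θ K₀ g₀ (kr F θ hP g₀ os) (bd F θ hP g₀ os) K 0) (crOfRecord₁₃KAt K₀ kr bd (fun _ _ _ _ _ => (fun _ _ _ => 0, fun _ _ _ => 0)) F θ hP g₀ os).W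
      (fun _ _ _ => 0) (fun _ _ _ => 0) (fun _ => 0) (crOfRecord₁₃KAt K₀ kr bd (fun _ _ _ _ _ => (fun _ _ _ => 0, fun _ _ _ => 0)) F θ hP g₀ os).δ := by
    refine hybridNE7_noShell hW hAK0 hBK0 hδ fun K => ?_
    obtain ⟨c, hc⟩ := hcore K
    exact ⟨c, fun t ht u hu => by simpa only [crOfRecord₁₃KAt, sub_zero] using hc t ht u hu⟩
  obtain ⟨hW0, hlt, hWs, hδ', hmass⟩ := (exists_sourceIndepBad_hybridNE7_iff (l₀ := (1 : ℝ)) (vol := (F.side : ℝ) ^ 4) (W := (crOfRecord₁₃KAt K₀ kr bd (fun _ _ _ _ _ => (fun _ _ _ => 0, fun _ _ _ => 0)) F θ hP g₀ os).W)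
    (δ := (crOfRecord₁₃KAt K₀ kr bd (fun _ _ _ _ _ => (fun _ _ _ => 0, fun _ _ _ => 0)) F θ hP g₀ os).δ) hAK0 hBK0 (T4MatchingAssembly.shellWeightBound_zero hAK0 hBK0)).mp ⟨_, hH⟩
  refine ⟨(crOfRecord₁₃KAt K₀ kr bd (fun _ _ _ _ _ => (fun _ _ _ => 0, fun _ _ _ => 0)) F θ hP g₀ os).W, (crOfRecord₁₃KAt K₀ kr bd (fun _ _ _ _ _ => (fun _ _ _ => 0, fun _ _ _ => 0)) F θ hP g₀ os).δ, hW0, fun K => by simpa using hlt K, hWs, hδ', fun K => ?_⟩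
  obtain ⟨c, hc⟩ := hmass K
  refine ⟨c, fun t' ht' => ?_⟩
  simpa only [sub_zero] using hc t' ht'

/-! ## §2 SUFFICIENCY: a bad-key reading that READS the violators, plus the tail letter, gives the faces [bookkeeping] -/

/-- **★★★ THE TAIL LETTER GIVES THE FACES** [bookkeeping].  Conversely: fix per-step centres `c_K`, a summable radius `δ` and weights `0 ≤ W_K < 1` summable; if at this tuple the
bad-key reading `bd` READS the violators (`bd K u ↔` «at some admissible source the coarse weights' log-ratio at `u` violates `e^{c_K ∓ F.side⁴·δ_K}`»), the tail letter holds
(violators' relative weight `≤ W_K` in both runs at every admissible source) and the fine weights are non-negative, then `crOfRecord₁₃KAt K₀ kr bd 0` carries `RelWeightBound` with its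
canonical `W` and `Core` with its canonical `δ`, summable (dag-n20-d's `relWeightBound_crOfRecord₁₃KAt` ∕ `core_crOfRecord₁₃KAt` BY NAME).  With §1: at a key reading with the
zero shell split, the N20 ∧ N19′ pair of stub 2 for SOME bad-key reading IS the two-run tail letter at the coarse carriers. -/
theorem faces_crOfRecord₁₃KAt_zeroShell_of_tailLetter {c W δ : ℕ → ℝ}
    (hbd : ∀ (K : ℕ) (u : Σ K, SiteSeqKey F (K₀ + K)), bd F θ hP g₀ os K u ↔ ∃ t : ℝ, |t| ≤ 1 ∧
      ¬ (Real.exp (c K - ((F.side : ℝ) ^ 4) * δ K) * weightAK₁₃ θ hP K₀ g₀ os (kr F θ hP g₀ os) K t u ≤ weightBK₁₃ θ hP K₀ g₀ os (kr F θ hP g₀ os) K t u ∧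
        weightBK₁₃ θ hP K₀ g₀ os (kr F θ hP g₀ os) K t u ≤ Real.exp (c K + ((F.side : ℝ) ^ 4) * δ K) * weightAK₁₃ θ hP K₀ g₀ os (kr F θ hP g₀ os) K t u))
    (hA0 : ∀ (K : ℕ) (t : ℝ), |t| ≤ 1 → ∀ x ∈ classSet₁₃ θ K₀ g₀ K, 0 ≤ weightA₁₃ θ hP K₀ g₀ os K t x)
    (hW0 : ∀ K, 0 ≤ W K) (hW1 : ∀ K, W K < 1) (hWs : Summable W) (hδ : Summable δ)
    (hmass : ∀ (K : ℕ) (t' : ℝ), |t'| ≤ 1 →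
      (∑ u ∈ badClassK₁₃ θ K₀ g₀ (kr F θ hP g₀ os) (bd F θ hP g₀ os) K t', weightAK₁₃ θ hP K₀ g₀ os (kr F θ hP g₀ os) K t' u ≤
          W K * ∑ u ∈ classSetK₁₃ θ K₀ g₀ (kr F θ hP g₀ os) K, weightAK₁₃ θ hP K₀ g₀ os (kr F θ hP g₀ os) K t' u) ∧
      (∑ u ∈ badClassK₁₃ θ K₀ g₀ (kr F θ hP g₀ os) (bd F θ hP g₀ os) K t', weightBK₁₃ θ hP K₀ g₀ os (kr F θ hP g₀ os) K t' u ≤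
          W K * ∑ u ∈ classSetK₁₃ θ K₀ g₀ (kr F θ hP g₀ os) K, weightBK₁₃ θ hP K₀ g₀ os (kr F θ hP g₀ os) K t' u)) :
    let cr := crOfRecord₁₃KAt K₀ kr bd (fun _ _ _ _ _ => (fun _ _ _ => 0, fun _ _ _ => 0)) F θ hP g₀ os
    RelWeightBound cr.l₀ cr.T cr.A cr.B cr.Bad cr.W ∧
      (letI := cr.dec
       Core cr.l₀ cr.vol cr.T cr.Bad (fun K t τ => cr.A K t τ - cr.shA K t τ) (fun K t τ => cr.B K t τ - cr.shB K t τ) cr.δ) ∧ Summable cr.δ := by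
  letI iS : DecidableEq (Σ K, SiteSeqKey F (K₀ + K)) := Classical.decEq _
  have hW : RelWeightBound 1 (classSetK₁₃ θ K₀ g₀ (kr F θ hP g₀ os)) (weightAK₁₃ θ hP K₀ g₀ os (kr F θ hP g₀ os)) (weightBK₁₃ θ hP K₀ g₀ os (kr F θ hP g₀ os))
      (badClassK₁₃ θ K₀ g₀ (kr F θ hP g₀ os) (bd F θ hP g₀ os)) W :=
    { bad_subset := fun K t _ => badClassK₁₃_subset θ K₀ g₀ (kr F θ hP g₀ os) (bd F θ hP g₀ os) K t
      nonneg := hW0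
      lt_one := hW1
      summable := hWs
      bad_left := fun K t ht => (hmass K t ht).1
      bad_right := fun K t ht => (hmass K t ht).2 }
  -- off the record's bad class the sandwich holds at every admissible source (the reading reads the violators)
  have hcore : Core 1 ((F.side : ℝ) ^ 4) (classSetK₁₃ θ K₀ g₀ (kr F θ hP g₀ os)) (badClassK₁₃ θ K₀ g₀ (kr F θ hP g₀ os) (bd F θ hP g₀ os))
      (fun K t u => weightAK₁₃ θ hP K₀ g₀ os (kr F θ hP g₀ os) K t u - (0 : ℝ)) (fun K t u => weightBK₁₃ θ hP K₀ g₀ os (kr F θ hP g₀ os) K t u - (0 : ℝ)) δ := by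
    intro K
    refine ⟨c K, fun t ht u hu => ?_⟩
    rw [Finset.mem_sdiff, mem_badClassK₁₃_iff, hbd, not_and] at hu
    have h := hu.2 hu.1
    simp only [sub_zero]
    by_contra hv
    exact h ⟨t, ht, hv⟩
  have hP0 : ∀ (K : ℕ) (t : ℝ), |t| ≤ 1 → ∀ u ∈ classSetK₁₃ θ K₀ g₀ (kr F θ hP g₀ os) K \ badClassK₁₃ θ K₀ g₀ (kr F θ hP g₀ os) (bd F θ hP g₀ os) K t,
      0 ≤ weightAK₁₃ θ hP K₀ g₀ os (kr F θ hP g₀ os) K t u - (0 : ℝ) := fun K t ht u _ => by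
    rw [sub_zero]
    exact weightAK₁₃_nonneg θ hP K₀ g₀ os (kr F θ hP g₀ os) (hA0 K t ht) u
  exact ⟨relWeightBound_crOfRecord₁₃KAt K₀ kr bd _ θ hP g₀ os hW, core_crOfRecord₁₃KAt K₀ kr bd _ θ hP g₀ os hP0 hcore hδ⟩


/-! # v1.1 (append-only): the same two directions at a PINNED, possibly non-zero, shell split `sh` of the reading's key (START-LIST §n20 «natural v6 pins `sh`») -/

section PinnedShell
open T4IndicatorShell (ShellWeightBound)
open T4MatchingAssembly (hybridNE7_of_relWeightBound)
variable (sh : ShellSplit₁₃CoPH N K₀)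

/-! ## §3 (v1.1, append-only) NECESSITY at a PINNED shell split `sh`: the N20 ∧ N21 ∧ lt-one ∧ N19′ face bodies at `crOfRecord₁₃KAt K₀ kr bd sh` force the tail letter for the SHELL-SUBTRACTED coarse weights [bookkeeping] -/

open Classical in
/-- **★★★ THE FACES AT A PINNED SHELL SPLIT FORCE THE TAIL LETTER** [bookkeeping].  For ANY dial `kr`, ANY shell split `sh` of the reading's key and ANY bad-key reading `bd`: if
`cr := crOfRecord₁₃KAt K₀ kr bd sh` carries `RelWeightBound cr… cr.W`, `ShellWeightBound cr… cr.shA cr.shB cr.Wsh`, `cr.W + cr.Wsh < 1` and `Core cr… (A − shA) (B − shB) cr.δ ∧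
Summable cr.δ` (the face bodies of stub 2 at `cr`), and the fine weights are non-negative, then with `Wsh :=` the reading's canonical shell weight there are `W ≥ 0` with
`W + Wsh < 1` summable, a summable `δ` and per step ONE centre `c_K` such that the coarse classes whose SHELL-SUBTRACTED weights violate `e^{c_K ∓ F.side⁴·δ_K}` at SOME admissible
source carry, at every admissible source, relative weight `≤ W_K` in both runs (p630231 `exists_sourceIndepBad_hybridNE7_iff` BY NAME). -/
theorem tailLetter_of_faces_crOfRecord₁₃KAt_pinnedShell
    (hA0 : ∀ (K : ℕ) (t : ℝ), |t| ≤ 1 → ∀ x ∈ classSet₁₃ θ K₀ g₀ K, 0 ≤ weightA₁₃ θ hP K₀ g₀ os K t x)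
    (hB0 : ∀ (K : ℕ) (t : ℝ), |t| ≤ 1 → ∀ x ∈ classSet₁₃ θ K₀ g₀ K, 0 ≤ weightB₁₃ θ hP K₀ g₀ os K t x)
    (hfaces : let cr := crOfRecord₁₃KAt K₀ kr bd sh F θ hP g₀ os
      RelWeightBound cr.l₀ cr.T cr.A cr.B cr.Bad cr.W ∧ ShellWeightBound cr.l₀ cr.T cr.A cr.B cr.shA cr.shB cr.Wsh ∧ (∀ K, cr.W K + cr.Wsh K < 1) ∧
        (letI := cr.dec
         Core cr.l₀ cr.vol cr.T cr.Bad (fun K t τ => cr.A K t τ - cr.shA K t τ) (fun K t τ => cr.B K t τ - cr.shB K t τ) cr.δ) ∧ Summable cr.δ) :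
    ∃ W δ : ℕ → ℝ, (∀ K, 0 ≤ W K) ∧ (∀ K, W K + (crOfRecord₁₃KAt K₀ kr bd sh F θ hP g₀ os).Wsh K < 1) ∧ Summable W ∧ Summable δ ∧
      ∀ K : ℕ, ∃ c : ℝ, ∀ t' : ℝ, |t'| ≤ 1 →
        letI : DecidableEq (Σ K, SiteSeqKey F (K₀ + K)) := Classical.decEq _
        (∑ u ∈ (classSetK₁₃ θ K₀ g₀ (kr F θ hP g₀ os) K).filter (fun u => ∃ t : ℝ, |t| ≤ 1 ∧
            ¬ (Real.exp (c - ((F.side : ℝ) ^ 4) * δ K) * (weightAK₁₃ θ hP K₀ g₀ os (kr F θ hP g₀ os) K t u - (sh F θ hP g₀ os).1 K t u) ≤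
                weightBK₁₃ θ hP K₀ g₀ os (kr F θ hP g₀ os) K t u - (sh F θ hP g₀ os).2 K t u ∧
              weightBK₁₃ θ hP K₀ g₀ os (kr F θ hP g₀ os) K t u - (sh F θ hP g₀ os).2 K t u ≤
                Real.exp (c + ((F.side : ℝ) ^ 4) * δ K) * (weightAK₁₃ θ hP K₀ g₀ os (kr F θ hP g₀ os) K t u - (sh F θ hP g₀ os).1 K t u))),
            weightAK₁₃ θ hP K₀ g₀ os (kr F θ hP g₀ os) K t' u ≤ W K * ∑ u ∈ classSetK₁₃ θ K₀ g₀ (kr F θ hP g₀ os) K, weightAK₁₃ θ hP K₀ g₀ os (kr F θ hP g₀ os) K t' u) ∧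
        (∑ u ∈ (classSetK₁₃ θ K₀ g₀ (kr F θ hP g₀ os) K).filter (fun u => ∃ t : ℝ, |t| ≤ 1 ∧
            ¬ (Real.exp (c - ((F.side : ℝ) ^ 4) * δ K) * (weightAK₁₃ θ hP K₀ g₀ os (kr F θ hP g₀ os) K t u - (sh F θ hP g₀ os).1 K t u) ≤
                weightBK₁₃ θ hP K₀ g₀ os (kr F θ hP g₀ os) K t u - (sh F θ hP g₀ os).2 K t u ∧
              weightBK₁₃ θ hP K₀ g₀ os (kr F θ hP g₀ os) K t u - (sh F θ hP g₀ os).2 K t u ≤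
                Real.exp (c + ((F.side : ℝ) ^ 4) * δ K) * (weightAK₁₃ θ hP K₀ g₀ os (kr F θ hP g₀ os) K t u - (sh F θ hP g₀ os).1 K t u))),
            weightBK₁₃ θ hP K₀ g₀ os (kr F θ hP g₀ os) K t' u ≤ W K * ∑ u ∈ classSetK₁₃ θ K₀ g₀ (kr F θ hP g₀ os) K, weightBK₁₃ θ hP K₀ g₀ os (kr F θ hP g₀ os) K t' u) := by
  letI iS : DecidableEq (Σ K, SiteSeqKey F (K₀ + K)) := Classical.decEq _
  obtain ⟨hW, hSh, hlt, hcore, hδ⟩ := hfaces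
  have hAK0 : ∀ (K : ℕ) (t : ℝ), |t| ≤ 1 → ∀ u ∈ classSetK₁₃ θ K₀ g₀ (kr F θ hP g₀ os) K, 0 ≤ weightAK₁₃ θ hP K₀ g₀ os (kr F θ hP g₀ os) K t u :=
    fun K t ht u _ => weightAK₁₃_nonneg θ hP K₀ g₀ os (kr F θ hP g₀ os) (hA0 K t ht) u
  have hBK0 : ∀ (K : ℕ) (t : ℝ), |t| ≤ 1 → ∀ u ∈ classSetK₁₃ θ K₀ g₀ (kr F θ hP g₀ os) K, 0 ≤ weightBK₁₃ θ hP K₀ g₀ os (kr F θ hP g₀ os) K t u :=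
    fun K t ht u _ => weightBK₁₃_nonneg θ hP K₀ g₀ os (kr F θ hP g₀ os) (hB0 K t ht) u
  have hSh' : ShellWeightBound 1 (classSetK₁₃ θ K₀ g₀ (kr F θ hP g₀ os)) (weightAK₁₃ θ hP K₀ g₀ os (kr F θ hP g₀ os)) (weightBK₁₃ θ hP K₀ g₀ os (kr F θ hP g₀ os))
      (sh F θ hP g₀ os).1 (sh F θ hP g₀ os).2 (crOfRecord₁₃KAt K₀ kr bd sh F θ hP g₀ os).Wsh := hSh
  have hH : HybridNE7 1 ((F.side : ℝ) ^ 4) (classSetK₁₃ θ K₀ g₀ (kr F θ hP g₀ os)) (weightAK₁₃ θ hP K₀ g₀ os (kr F θ hP g₀ os)) (weightBK₁₃ θ hP K₀ g₀ os (kr F θ hP g₀ os))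
      (fun K _ => badClassK₁₃ θ K₀ g₀ (kr F θ hP g₀ os) (bd F θ hP g₀ os) K 0) (crOfRecord₁₃KAt K₀ kr bd sh F θ hP g₀ os).W
      (sh F θ hP g₀ os).1 (sh F θ hP g₀ os).2 (crOfRecord₁₃KAt K₀ kr bd sh F θ hP g₀ os).Wsh (crOfRecord₁₃KAt K₀ kr bd sh F θ hP g₀ os).δ := by
    refine hybridNE7_of_relWeightBound hW hSh' hlt hδ fun K => ?_
    obtain ⟨c, hc⟩ := hcore K
    exact ⟨c, fun t ht u hu => hc t ht u hu⟩
  obtain ⟨hW0, hlt', hWs, hδ', hmass⟩ := (exists_sourceIndepBad_hybridNE7_iff (l₀ := (1 : ℝ)) (vol := (F.side : ℝ) ^ 4) (W := (crOfRecord₁₃KAt K₀ kr bd sh F θ hP g₀ os).W)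
    (δ := (crOfRecord₁₃KAt K₀ kr bd sh F θ hP g₀ os).δ) hAK0 hBK0 hSh').mp ⟨_, hH⟩
  exact ⟨(crOfRecord₁₃KAt K₀ kr bd sh F θ hP g₀ os).W, (crOfRecord₁₃KAt K₀ kr bd sh F θ hP g₀ os).δ, hW0, hlt', hWs, hδ', hmass⟩

/-! ## §4 (v1.1, append-only) SUFFICIENCY at a pinned shell split: a reading that reads the violators of the shell-subtracted sandwich + the tail letter + a shell witness ⇒ the faces [bookkeeping] -/

/-- **★★★ THE TAIL LETTER GIVES THE FACES AT A PINNED SHELL SPLIT** [bookkeeping].  Centres `c`, a summable `δ`, weights `0 ≤ W` summable, a shell witness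
`ShellWeightBound 1 classSetK₁₃ weightAK₁₃ weightBK₁₃ sh.1 sh.2 Wsh` with `W + Wsh < 1`, a bad-key reading `bd` that READS the violators of the shell-subtracted sandwich at the tuple, and
the tail letter on `badClassK₁₃ kr bd` ⇒ at `cr := crOfRecord₁₃KAt K₀ kr bd sh`: `RelWeightBound cr… cr.W`, `ShellWeightBound cr… cr.Wsh`, `cr.W + cr.Wsh < 1`,
`Core cr… (A − shA) (B − shB) cr.δ`, `Summable cr.δ` (dag-n20-d's four transfer lemmas BY NAME). -/
theorem faces_crOfRecord₁₃KAt_pinnedShell_of_tailLetter {c W Wsh δ : ℕ → ℝ}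
    (hbd : ∀ (K : ℕ) (u : Σ K, SiteSeqKey F (K₀ + K)), bd F θ hP g₀ os K u ↔ ∃ t : ℝ, |t| ≤ 1 ∧
      ¬ (Real.exp (c K - ((F.side : ℝ) ^ 4) * δ K) * (weightAK₁₃ θ hP K₀ g₀ os (kr F θ hP g₀ os) K t u - (sh F θ hP g₀ os).1 K t u) ≤
          weightBK₁₃ θ hP K₀ g₀ os (kr F θ hP g₀ os) K t u - (sh F θ hP g₀ os).2 K t u ∧
        weightBK₁₃ θ hP K₀ g₀ os (kr F θ hP g₀ os) K t u - (sh F θ hP g₀ os).2 K t u ≤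
          Real.exp (c K + ((F.side : ℝ) ^ 4) * δ K) * (weightAK₁₃ θ hP K₀ g₀ os (kr F θ hP g₀ os) K t u - (sh F θ hP g₀ os).1 K t u)))
    (hSh : ShellWeightBound 1 (classSetK₁₃ θ K₀ g₀ (kr F θ hP g₀ os)) (weightAK₁₃ θ hP K₀ g₀ os (kr F θ hP g₀ os)) (weightBK₁₃ θ hP K₀ g₀ os (kr F θ hP g₀ os))
      (sh F θ hP g₀ os).1 (sh F θ hP g₀ os).2 Wsh)
    (hW0 : ∀ K, 0 ≤ W K) (hlt : ∀ K, W K + Wsh K < 1) (hWs : Summable W) (hδ : Summable δ)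
    (hmass : ∀ (K : ℕ) (t' : ℝ), |t'| ≤ 1 →
      (∑ u ∈ badClassK₁₃ θ K₀ g₀ (kr F θ hP g₀ os) (bd F θ hP g₀ os) K t', weightAK₁₃ θ hP K₀ g₀ os (kr F θ hP g₀ os) K t' u ≤
          W K * ∑ u ∈ classSetK₁₃ θ K₀ g₀ (kr F θ hP g₀ os) K, weightAK₁₃ θ hP K₀ g₀ os (kr F θ hP g₀ os) K t' u) ∧
      (∑ u ∈ badClassK₁₃ θ K₀ g₀ (kr F θ hP g₀ os) (bd F θ hP g₀ os) K t', weightBK₁₃ θ hP K₀ g₀ os (kr F θ hP g₀ os) K t' u ≤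
          W K * ∑ u ∈ classSetK₁₃ θ K₀ g₀ (kr F θ hP g₀ os) K, weightBK₁₃ θ hP K₀ g₀ os (kr F θ hP g₀ os) K t' u)) :
    let cr := crOfRecord₁₃KAt K₀ kr bd sh F θ hP g₀ os
    RelWeightBound cr.l₀ cr.T cr.A cr.B cr.Bad cr.W ∧ ShellWeightBound cr.l₀ cr.T cr.A cr.B cr.shA cr.shB cr.Wsh ∧ (∀ K, cr.W K + cr.Wsh K < 1) ∧
      (letI := cr.dec
       Core cr.l₀ cr.vol cr.T cr.Bad (fun K t τ => cr.A K t τ - cr.shA K t τ) (fun K t τ => cr.B K t τ - cr.shB K t τ) cr.δ) ∧ Summable cr.δ := by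
  letI iS : DecidableEq (Σ K, SiteSeqKey F (K₀ + K)) := Classical.decEq _
  have hW : RelWeightBound 1 (classSetK₁₃ θ K₀ g₀ (kr F θ hP g₀ os)) (weightAK₁₃ θ hP K₀ g₀ os (kr F θ hP g₀ os)) (weightBK₁₃ θ hP K₀ g₀ os (kr F θ hP g₀ os))
      (badClassK₁₃ θ K₀ g₀ (kr F θ hP g₀ os) (bd F θ hP g₀ os)) W :=
    { bad_subset := fun K t _ => badClassK₁₃_subset θ K₀ g₀ (kr F θ hP g₀ os) (bd F θ hP g₀ os) K t
      nonneg := hW0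
      lt_one := fun K => by linarith [hlt K, hSh.nonneg K]
      summable := hWs
      bad_left := fun K t ht => (hmass K t ht).1
      bad_right := fun K t ht => (hmass K t ht).2 }
  have hcore : Core 1 ((F.side : ℝ) ^ 4) (classSetK₁₃ θ K₀ g₀ (kr F θ hP g₀ os)) (badClassK₁₃ θ K₀ g₀ (kr F θ hP g₀ os) (bd F θ hP g₀ os))
      (fun K t u => weightAK₁₃ θ hP K₀ g₀ os (kr F θ hP g₀ os) K t u - (sh F θ hP g₀ os).1 K t u)
      (fun K t u => weightBK₁₃ θ hP K₀ g₀ os (kr F θ hP g₀ os) K t u - (sh F θ hP g₀ os).2 K t u) δ := by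
    intro K
    refine ⟨c K, fun t ht u hu => ?_⟩
    rw [Finset.mem_sdiff, mem_badClassK₁₃_iff, hbd, not_and] at hu
    have h := hu.2 hu.1
    by_contra hv
    exact h ⟨t, ht, hv⟩
  have hP0 : ∀ (K : ℕ) (t : ℝ), |t| ≤ 1 → ∀ u ∈ classSetK₁₃ θ K₀ g₀ (kr F θ hP g₀ os) K \ badClassK₁₃ θ K₀ g₀ (kr F θ hP g₀ os) (bd F θ hP g₀ os) K t,
      0 ≤ weightAK₁₃ θ hP K₀ g₀ os (kr F θ hP g₀ os) K t u - (sh F θ hP g₀ os).1 K t u := fun K t ht u hu =>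
    sub_nonneg.mpr (hSh.sh_le_left K t ht u (Finset.mem_sdiff.mp hu).1)
  exact ⟨relWeightBound_crOfRecord₁₃KAt K₀ kr bd sh θ hP g₀ os hW, shellWeightBound_crOfRecord₁₃KAt K₀ kr bd sh θ hP g₀ os hSh,
    lt_one_crOfRecord₁₃KAt K₀ kr bd sh θ hP g₀ os hW hSh hlt, core_crOfRecord₁₃KAt K₀ kr bd sh θ hP g₀ os hP0 hcore hδ⟩

end PinnedShell


/-! # v1.2 (append-only): the EXISTENCE form — «∃ bad-key reading, the faces» ⟺ the tail letter, at the record object -/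

section ExistsReading
open Classical in
/-- **★★★ THE EQUIVALENCE AT THE RECORD, ZERO SHELL SPLIT** [bookkeeping].  For ANY dial `kr` (non-negative fine weights): SOME bad-key reading `bd : BadKeyReading₁₃ N K₀` makes
`crOfRecord₁₃KAt K₀ kr bd 0` carry N20's `RelWeightBound cr… cr.W` and N19′'s `Core cr… cr.δ ∧ Summable cr.δ` **iff** there are `0 ≤ W < 1` summable, a summable `δ` and per step
ONE centre `c_K` with the two-run TAIL letter at the `kr`-coarse carriers (violators of `e^{c_K ∓ F.side⁴·δ_K}` at SOME admissible source carry relative weight `≤ W_K` in both runs at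
EVERY admissible source).  ⇒ is §1; ⇐ is §2 at the violator reading `bd := fun F θ hP g₀ os K u => ∃ |t| ≤ 1, violation` (a term — no definition is introduced). -/
theorem exists_badKeyReading_faces_crOfRecord₁₃KAt_zeroShell_iff
    (hA0 : ∀ (K : ℕ) (t : ℝ), |t| ≤ 1 → ∀ x ∈ classSet₁₃ θ K₀ g₀ K, 0 ≤ weightA₁₃ θ hP K₀ g₀ os K t x)
    (hB0 : ∀ (K : ℕ) (t : ℝ), |t| ≤ 1 → ∀ x ∈ classSet₁₃ θ K₀ g₀ K, 0 ≤ weightB₁₃ θ hP K₀ g₀ os K t x) :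
    (∃ bd : BadKeyReading₁₃ N K₀, let cr := crOfRecord₁₃KAt K₀ kr bd (fun _ _ _ _ _ => (fun _ _ _ => 0, fun _ _ _ => 0)) F θ hP g₀ os
      RelWeightBound cr.l₀ cr.T cr.A cr.B cr.Bad cr.W ∧
        (letI := cr.dec
         Core cr.l₀ cr.vol cr.T cr.Bad (fun K t τ => cr.A K t τ - cr.shA K t τ) (fun K t τ => cr.B K t τ - cr.shB K t τ) cr.δ) ∧ Summable cr.δ) ↔
    ∃ W δ c : ℕ → ℝ, (∀ K, 0 ≤ W K) ∧ (∀ K, W K < 1) ∧ Summable W ∧ Summable δ ∧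
      ∀ (K : ℕ) (t' : ℝ), |t'| ≤ 1 →
        letI : DecidableEq (Σ K, SiteSeqKey F (K₀ + K)) := Classical.decEq _
        (∑ u ∈ (classSetK₁₃ θ K₀ g₀ (kr F θ hP g₀ os) K).filter (fun u => ∃ t : ℝ, |t| ≤ 1 ∧
            ¬ (Real.exp (c K - ((F.side : ℝ) ^ 4) * δ K) * weightAK₁₃ θ hP K₀ g₀ os (kr F θ hP g₀ os) K t u ≤ weightBK₁₃ θ hP K₀ g₀ os (kr F θ hP g₀ os) K t u ∧
              weightBK₁₃ θ hP K₀ g₀ os (kr F θ hP g₀ os) K t u ≤ Real.exp (c K + ((F.side : ℝ) ^ 4) * δ K) * weightAK₁₃ θ hP K₀ g₀ os (kr F θ hP g₀ os) K t u)),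
            weightAK₁₃ θ hP K₀ g₀ os (kr F θ hP g₀ os) K t' u ≤ W K * ∑ u ∈ classSetK₁₃ θ K₀ g₀ (kr F θ hP g₀ os) K, weightAK₁₃ θ hP K₀ g₀ os (kr F θ hP g₀ os) K t' u) ∧
        (∑ u ∈ (classSetK₁₃ θ K₀ g₀ (kr F θ hP g₀ os) K).filter (fun u => ∃ t : ℝ, |t| ≤ 1 ∧
            ¬ (Real.exp (c K - ((F.side : ℝ) ^ 4) * δ K) * weightAK₁₃ θ hP K₀ g₀ os (kr F θ hP g₀ os) K t u ≤ weightBK₁₃ θ hP K₀ g₀ os (kr F θ hP g₀ os) K t u ∧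
              weightBK₁₃ θ hP K₀ g₀ os (kr F θ hP g₀ os) K t u ≤ Real.exp (c K + ((F.side : ℝ) ^ 4) * δ K) * weightAK₁₃ θ hP K₀ g₀ os (kr F θ hP g₀ os) K t u)),
            weightBK₁₃ θ hP K₀ g₀ os (kr F θ hP g₀ os) K t' u ≤ W K * ∑ u ∈ classSetK₁₃ θ K₀ g₀ (kr F θ hP g₀ os) K, weightBK₁₃ θ hP K₀ g₀ os (kr F θ hP g₀ os) K t' u) := by
  letI iS : DecidableEq (Σ K, SiteSeqKey F (K₀ + K)) := Classical.decEq _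
  constructor
  · rintro ⟨bd, hfaces⟩
    obtain ⟨W, δ, hW0, hW1, hWs, hδ, hmass⟩ := tailLetter_of_faces_crOfRecord₁₃KAt K₀ kr bd θ hP g₀ os hA0 hB0 hfaces
    choose c hc using hmass
    exact ⟨W, δ, c, hW0, hW1, hWs, hδ, fun K t' ht' => hc K t' ht'⟩
  · rintro ⟨W, δ, c, hW0, hW1, hWs, hδ, hmass⟩
    -- the violator reading (a term of the reading type; at other families it reads the same formula)
    refine ⟨fun F' θ' hP' g₀' os' K u => ∃ t : ℝ, |t| ≤ 1 ∧
        ¬ (Real.exp (c K - ((F'.side : ℝ) ^ 4) * δ K) * weightAK₁₃ θ' hP' K₀ g₀' os' (kr F' θ' hP' g₀' os') K t u ≤ weightBK₁₃ θ' hP' K₀ g₀' os' (kr F' θ' hP' g₀' os') K t u ∧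
          weightBK₁₃ θ' hP' K₀ g₀' os' (kr F' θ' hP' g₀' os') K t u ≤ Real.exp (c K + ((F'.side : ℝ) ^ 4) * δ K) * weightAK₁₃ θ' hP' K₀ g₀' os' (kr F' θ' hP' g₀' os') K t u), ?_⟩
    refine faces_crOfRecord₁₃KAt_zeroShell_of_tailLetter K₀ kr _ θ hP g₀ os (c := c) (W := W) (δ := δ) (fun K u => Iff.rfl) hA0 hW0 hW1 hWs hδ fun K t' ht' => ?_
    have e : badClassK₁₃ θ K₀ g₀ (kr F θ hP g₀ os) (fun K u => ∃ t : ℝ, |t| ≤ 1 ∧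
        ¬ (Real.exp (c K - ((F.side : ℝ) ^ 4) * δ K) * weightAK₁₃ θ hP K₀ g₀ os (kr F θ hP g₀ os) K t u ≤ weightBK₁₃ θ hP K₀ g₀ os (kr F θ hP g₀ os) K t u ∧
          weightBK₁₃ θ hP K₀ g₀ os (kr F θ hP g₀ os) K t u ≤ Real.exp (c K + ((F.side : ℝ) ^ 4) * δ K) * weightAK₁₃ θ hP K₀ g₀ os (kr F θ hP g₀ os) K t u)) K t' =
        (classSetK₁₃ θ K₀ g₀ (kr F θ hP g₀ os) K).filter (fun u => ∃ t : ℝ, |t| ≤ 1 ∧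
          ¬ (Real.exp (c K - ((F.side : ℝ) ^ 4) * δ K) * weightAK₁₃ θ hP K₀ g₀ os (kr F θ hP g₀ os) K t u ≤ weightBK₁₃ θ hP K₀ g₀ os (kr F θ hP g₀ os) K t u ∧
            weightBK₁₃ θ hP K₀ g₀ os (kr F θ hP g₀ os) K t u ≤ Real.exp (c K + ((F.side : ℝ) ^ 4) * δ K) * weightAK₁₃ θ hP K₀ g₀ os (kr F θ hP g₀ os) K t u)) := by
      ext u
      rw [mem_badClassK₁₃_iff, Finset.mem_filter]
    rw [e]
    exact hmass K t' ht'

end ExistsReading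

end Summit.QuantumFields.YangMills.BalabanUVNodes.N19TailLetterAtKeyReading
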